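import Literature.Computability.AlgebraicComplexity.BorderComplexityAlder
import Literature.Computability.AlgebraicComplexity.OrbitClosureEuclidean
import Literature.Computability.AlgebraicComplexity.FormTorusInstability
import HarnessLib

/-!
# The Euclidean and the Zariski closure of a size class coincide (Bürgisser 2024 survey,
# Thm. 4.19; BLMW 2011, remark after Def. 9.3.1) — PROVED

Topic `Computability/AlgebraicComplexity`. Cell `val-lit`, row Bur2024-A (Bürgisser's 2024 survey,
arXiv:2406.06217), §4.7 "Closures of complexity classes", companion of `BorderComplexityAlder.lean`
(Thm. 4.20). The survey defines `L̲` by Zariski closures (Def. 4.18) and states: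

> **Theorem 4.19.** Suppose `𝔽 = ℂ`. If we take in Definition 4.18 the closures with respect to the
> Euclidean topology, we get the same notion `L̲`. *Proof.* This follows from a general principle in
> algebraic geometry [mumf:88], which states that the Zariski closure of a constructible subset of
> `ℂ^N` coincides with its Euclidean closure. (held text `paper:arxiv-2406.06217`, p0021 L10–L20.)

This is also the sentence by which the tree's `approxComplexity` (`BLMW11KroneckerApproximation.lean`)
justifies rendering BLMW's Def. 9.3.1 ("`f` is in the closure of `{g ∈ A | L(g) ≤ r}`") by the
Zariski closure in coefficient space. Here it is PROVED, in the tree's currencies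
(`coeffVec : ℂ[x_σ] → ((σ →₀ ℕ) → ℂ)`, product topology on the target, `zariskiClosure`):

* `zariskiClosure_coeffVec_setOf_complexity_le_eq_closure` — for every `r`,
  `zariskiClosure (coeffVec '' {g | L(g) ≤ r}) = closure (coeffVec '' {g | L(g) ≤ r})`;
* `approxComplexity_eq_sInf_closure` — `\underline{L}(f)` computed with Euclidean closures is the
  same number (Thm. 4.19 verbatim for the tree's `approxComplexity`);
* `borderComplexity_le_iff_coeffVec_mem_closure` — with Alder's theorem
  (`BorderComplexityAlder.lean`): `L̲(f) ≤ r` (a border computation over `ℂ((ε))` of size `≤ r`)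
  iff `f` is a Euclidean limit of polynomials of circuit size `≤ r` (Def. 4.18 + Thm. 4.19 +
  Thm. 4.20 in one line; BLMW 2011 Def. 9.3.1 as printed).

## Proof

The inclusion `closure ⊆ zariskiClosure` is the continuity of polynomials
(`closure_subset_zariskiClosure`, any index set). Conversely (the "general principle", here via
Chevalley's theorem and the density theorem SGA1 XII 2.2 as packaged in the tree's
`mem_closure_range_of_ker_bind₁_le`, `OrbitClosureEuclidean.lean`): by
`CircuitCount.exists_shape_eval_eq` and `zariskiClosure_iUnion_subset` (`BorderComplexityAlder.lean`)
a point `z` of the Zariski closure of the size class lies in the Zariski closure of the image of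
ONE generic computation `a ↦ G_sh(a)` (Bürgisser 2004 §5.3); its coordinates outside the finite
support of the generic polynomial `G_sh` vanish; on that finite set of coordinates closure
membership is the kernel condition `ker (P^*) ≤ 𝔪_z`, so `z` is a classical limit of image points
there, and extending by zero (a continuous map) gives the claim, since every image point is the
coefficient vector of a polynomial of circuit size `≤ r`.

Theorems only (no definitions, no named facts). Honest framing: a closure lemma of algebraic
geometry applied to size classes; nothing here bears on `VP` versus `\overline{VP}` versus `VNP`,
and `VP ≠ VNP` is NOT proved.

## References

* [Burgisser2024Completeness] P. Bürgisser, arXiv:2406.06217 (2024), §4.7, Def. 4.18 and Thm. 4.19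
  (held text p0021 L1–L20).
* [BurgisserEtAl2011] Bürgisser–Landsberg–Manivel–Weyman, SIAM J. Comput. 40 (2011), Def. 9.3.1
  and the remark following it ("the same complexity notions are obtained when using the Zariski
  topology, since constructible sets have the same closure with respect to Euclidean and Zariski
  topology").
* [Burgisser2004Factors] P. Bürgisser, Found. Comput. Math. 4 (2004), §5.3 (generic computations).
* [LandsbergGCT2017] J. M. Landsberg, *Geometry and Complexity Theory*, CUP 2017, Thm. 3.1.6.1.
-/

noncomputable section

open MvPolynomial
open scoped Topology

namespace Literature.Computability.AlgebraicComplexity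

open CircuitCount

section Euclidean

/-- The polynomial computed by a specialised generic computation of length `r` has circuit size
`≤ r` (it is computed by the decoded code, a fan-in-two circuit with `r` gates).
[cite: Burgisser2004Factors, §5.3 (`im φ_Γ ⊆ C_r`)] -/
theorem CircuitCount.complexity_map_eval_genCode_le {K : Type*} [CommSemiring K] {σ : Type*}
    {r : ℕ} (sh : Code Unit σ r) (a : Slot r → K) :
    complexity (MvPolynomial.map (MvPolynomial.eval a) (decode (genCode K sh)).eval) ≤ r := by
  rw [← ArithCircuit.eval_map_apply]
  have h := ArithCircuit.complexity_le_size ((isFanInTwo_decode (genCode K sh)).map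
    (MvPolynomial.eval a)) rfl
  rwa [ArithCircuit.size_map, size_decode] at h

variable {σ : Type*} [Fintype σ] [DecidableEq σ]

/-- **Bürgisser 2024, Thm. 4.19 / BLMW 2011, remark after Def. 9.3.1 — PROVED.** Over `ℂ`, for
every `r`, the Zariski closure and the Euclidean (product-topology) closure of the set of
coefficient vectors of the polynomials of fan-in-two circuit size `≤ r` coincide ("the Zariski
closure of a constructible subset of `ℂ^N` coincides with its Euclidean closure", applied to the
size class `{f | L(f) ≤ s}`, a finite union of images of the generic computations).
[cite: Burgisser2024Completeness, Thm. 4.19 (§4.7, p0021 L12–L20)] [cite: BurgisserEtAl2011, Def. 9.3.1 (remark following it)] [cite: LandsbergGCT2017, Thm. 3.1.6.1] -/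
theorem zariskiClosure_coeffVec_setOf_complexity_le_eq_closure (r : ℕ) :
    zariskiClosure (coeffVec '' {g : MvPolynomial σ ℂ | complexity g ≤ r}) =
      closure (coeffVec '' {g : MvPolynomial σ ℂ | complexity g ≤ r}) := by
  classical
  refine Set.Subset.antisymm ?_ (closure_subset_zariskiClosure _)
  intro z hz
  -- reduction to ONE generic computation (Bürgisser 2004 §5.3)
  let G : Code Unit σ r → MvPolynomial σ (MvPolynomial (Slot r) ℂ) :=
    fun sh => (decode (genCode ℂ sh)).eval
  let Φ : Code Unit σ r → (Slot r → ℂ) → MvPolynomial σ ℂ :=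
    fun sh a => MvPolynomial.map (MvPolynomial.eval a) (G sh)
  have hcover : coeffVec '' {g : MvPolynomial σ ℂ | complexity g ≤ r} ⊆
      ⋃ sh, coeffVec '' Set.range (Φ sh) := by
    rintro _ ⟨g, hg, rfl⟩
    obtain ⟨sh, a, ha⟩ := exists_shape_eval_eq ℂ hg
    exact Set.mem_iUnion.mpr ⟨sh, g, ⟨a, ha⟩, rfl⟩
  obtain ⟨sh, hsh⟩ := Set.mem_iUnion.mp
    (zariskiClosure_iUnion_subset _ (zariskiClosure_mono hcover hz))
  have hΦmem : ∀ a, coeffVec (Φ sh a) ∈ coeffVec '' {g : MvPolynomial σ ℂ | complexity g ≤ r} :=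
    fun a => ⟨Φ sh a, complexity_map_eval_genCode_le sh a, rfl⟩
  -- the coordinates of `z` outside the support of the generic polynomial vanish
  let S : Finset (σ →₀ ℕ) := (G sh).support
  have hcoeffΦ : ∀ (a : Slot r → ℂ) (m : σ →₀ ℕ),
      coeffVec (Φ sh a) m = aeval a (coeff m (G sh)) := fun a m => by
    simp only [coeffVec_apply, Φ, coeff_map]
    rfl
  have hzero : ∀ m ∉ S, z m = 0 := by
    intro m hm
    have hGm : coeff m (G sh) = 0 := notMem_support_iff.mp hm
    have h := (mem_zariskiClosure_iff.mp hsh) (X m) (by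
      rintro _ ⟨_, ⟨a, rfl⟩, rfl⟩
      rw [aeval_X, hcoeffΦ, hGm, map_zero])
    rwa [aeval_X] at h
  -- on the finitely many coordinates `S`: the kernel condition, hence a classical limit
  let P : S → MvPolynomial (Slot r) ℂ := fun t => coeff (t : σ →₀ ℕ) (G sh)
  have hker : RingHom.ker (bind₁ P : MvPolynomial S ℂ →ₐ[ℂ] MvPolynomial (Slot r) ℂ) ≤
      RingHom.ker (aeval (fun t : S => z t) : MvPolynomial S ℂ →ₐ[ℂ] ℂ) := by
    intro Q hQ
    rw [RingHom.mem_ker] at hQ ⊢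
    have hvan : ∀ y ∈ coeffVec '' Set.range (Φ sh),
        aeval y (rename (fun t : S => (t : σ →₀ ℕ)) Q) = 0 := by
      rintro _ ⟨_, ⟨a, rfl⟩, rfl⟩
      rw [aeval_rename]
      have hfun : (coeffVec (Φ sh a) ∘ fun t : S => (t : σ →₀ ℕ)) =
          fun t => aeval a (P t) := by
        funext t
        exact hcoeffΦ a t
      rw [hfun, ← comp_aeval, AlgHom.comp_apply]
      change aeval a (bind₁ P Q) = 0
      rw [hQ, map_zero]
    have h0 := (mem_zariskiClosure_iff.mp hsh) _ hvan
    rwa [aeval_rename] at h0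
  have hcl := mem_closure_range_of_ker_bind₁_le P hker
  -- extension by zero from `S → ℂ` to the whole coefficient space
  let e : (S → ℂ) → ((σ →₀ ℕ) → ℂ) := fun w m => if h : m ∈ S then w ⟨m, h⟩ else 0
  have he : Continuous e := by
    refine continuous_pi fun m => ?_
    by_cases h : m ∈ S
    · simp only [e, dif_pos h]
      exact continuous_apply _
    · simp only [e, dif_neg h]
      exact continuous_const
  have hez : e (fun t : S => z t) = z := by
    funext m
    by_cases h : m ∈ S
    · simp only [e, dif_pos h]
    · simp only [e, dif_neg h]
      exact (hzero m h).symm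
  have heΦ : ∀ a : Slot r → ℂ, e (fun t : S => aeval a (P t)) = coeffVec (Φ sh a) := by
    intro a
    funext m
    by_cases h : m ∈ S
    · simp only [e, dif_pos h]
      exact (hcoeffΦ a m).symm
    · simp only [e, dif_neg h]
      rw [hcoeffΦ, notMem_support_iff.mp h, map_zero]
  have himage : e '' Set.range (fun (x : Slot r → ℂ) (t : S) => aeval x (P t)) ⊆
      coeffVec '' {g : MvPolynomial σ ℂ | complexity g ≤ r} := by
    rintro _ ⟨_, ⟨a, rfl⟩, rfl⟩
    rw [heΦ]
    exact hΦmem a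
  rw [← hez]
  exact closure_mono himage (image_closure_subset_closure_image he ⟨_, hcl, rfl⟩)

/-- **Bürgisser 2024, Thm. 4.19 for the tree's `approxComplexity`**: BLMW's `\underline{L}(f)`
("the minimum `r` such that `f` is in the closure of `{g | L(g) ≤ r}`", Def. 9.3.1, Euclidean
closure) equals the tree's Zariski-closure rendering `approxComplexity f`.
[cite: Burgisser2024Completeness, Thm. 4.19 (§4.7, p0021 L12–L20)] [cite: BurgisserEtAl2011, Def. 9.3.1] -/
theorem approxComplexity_eq_sInf_closure (f : MvPolynomial σ ℂ) :
    approxComplexity f =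
      sInf {r | coeffVec f ∈ closure (coeffVec '' {g : MvPolynomial σ ℂ | complexity g ≤ r})} := by
  simp only [approxComplexity, zariskiClosure_coeffVec_setOf_complexity_le_eq_closure]

/-- **Def. 4.18 + Thm. 4.19 + Thm. 4.20 of the survey in one line (BLMW 2011 Def. 9.3.1 as printed,
Euclidean closure): over `ℂ`, `L̲(f) ≤ r` — a fan-in-two circuit of size `≤ r` over `ℂ((ε))`
computing `f + O(ε)` — iff the coefficient vector of `f` is a limit, in the Euclidean (product)
topology, of coefficient vectors of polynomials of circuit size `≤ r`.**
[cite: Burgisser2024Completeness, Def. 4.18, Thm. 4.19, Thm. 4.20 (§4.7, p0021)] [cite: BurgisserEtAl2011, Def. 9.3.1] -/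
theorem borderComplexity_le_iff_coeffVec_mem_closure (f : MvPolynomial σ ℂ) (r : ℕ) :
    borderComplexity f ≤ r ↔
      coeffVec f ∈ closure (coeffVec '' {g : MvPolynomial σ ℂ | complexity g ≤ r}) := by
  rw [borderComplexity_le_iff_coeffVec_mem_zariskiClosure,
    zariskiClosure_coeffVec_setOf_complexity_le_eq_closure]

end Euclidean

end Literature.Computability.AlgebraicComplexity

end
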